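import Summits.Ventures.KdS.RouteWSpinFlip
import HarnessLib

/-!
# Venture KdS — the spin flip on the cosmological lattice (II): the kernel of the
# Teukolsky–Starobinsky map is polynomial (clause (c) of the spin-flip chain)

HONEST FRAMING (venture `Summits/Ventures/KdS`, cell `pub-kds`; LIT-1 g22 under lead ruling A86,
following P1 g5's recipe `theory/P1-HANDOFF-g5.md §RESIDUAL`). `RouteW.spinFlip_core`
(`RouteWSpinFlip.lean`, landed, append-only) exports, when the spin-`−s` image `R'` of a
generic-boundary spin-`s` radial solution `R` vanishes, (a) `R ≡ 0` off the cosmological lattice and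
(b) the accessory condition of the monomial at the EXTREME lattice point. This file re-runs the same
chain (Hatsuda gauge → exponent flip → Umetsu's `2s`-th derivative → flip back; parts (1)–(3) are
copied verbatim from `spinFlip_core`, whose internals are not exported) and proves clause **(c)**,
valid at EVERY lattice point `s + 2B(r_c) = j ∈ ℕ`, `j ≤ 2s − 1`: if `R' ≡ 0` then the Hatsuda-gauge
function `y = R/w ∘ r(x)` of `R` is
`y(x) = x^{1−γ} (z_r − x)^{1−ε} · r(x)` on `(0,1)` for a POLYNOMIAL `r` of degree `≤ 2s − 1 − j`
(`spinFlip_polynomial`). Mechanism: `ỹ^{(2s)} ≡ 0` makes `ỹ = x^{γ−1}(1−x)^{δ−1}(z_r−x)^{ε−1}y` a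
polynomial `P` of degree `≤ 2s−1` (`SpinFlipTS.exists_polynomial_of_iterate_deriv_eq_zero`); the
outgoing branch `ỹ = (1−x)^{δ−1}·G₁`, `δ − 1 = j`, `G₁` smooth across `1`, forces `(X−1)^j ∣ P`
(`SpinFlipTS.natural_of_smooth_branch`), and `r = ±P/(X−1)^j`. The non-extreme strata
(`j < 2s−1`, polynomial kernels of positive degree) are then excluded in `RouteWSpinFlipStrata.lean`
by the formal Euler partner of `SpinFlipIntertwine.lean` / `SpinFlipFrobenius.lean`. 0 cited facts.
-/

noncomputable section

open Set Complex Filter Topology Polynomial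

namespace Summit.Ventures.KdS

namespace SpinFlipTS

open Literature.Geometry.Lorentzian.Kerr.Costa2019 (iterate_deriv_smooth iterate_deriv_eqOn)
open Literature.Analysis.ODE Literature.Analysis.ODE.GeneralHeun
open Literature.Geometry.Lorentzian Literature.Geometry.Lorentzian.KerrDeSitter

/-! ### Smoothness helpers (principal powers of positive reals) -/

/-- `t ↦ t^p` is smooth on `(0, ∞)` (real variable, principal complex power). -/
private theorem contDiffOn_ofReal_cpow (p : ℂ) :
    ContDiffOn ℝ ((⊤ : ℕ∞) : WithTop ℕ∞) (fun t : ℝ => (t : ℂ) ^ p) (Ioi 0) := by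
  intro x hx
  have hslit : ((x : ℝ) : ℂ) ∈ slitPlane := Complex.ofReal_mem_slitPlane.2 hx
  have h1 : AnalyticAt ℂ (fun z : ℂ => z ^ p) (x : ℂ) := analyticAt_id.cpow analyticAt_const hslit
  have h3 : AnalyticAt ℝ (fun y : ℝ => (y : ℂ)) x := Complex.ofRealCLM.analyticAt x
  have h4 : AnalyticAt ℝ (fun y : ℝ => ((y : ℂ)) ^ p) x :=
    AnalyticAt.comp (g := fun z : ℂ => z ^ p) (f := fun y : ℝ => (y : ℂ)) (x := x)
      h1.restrictScalars h3
  exact h4.contDiffAt.contDiffWithinAt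

/-- `x ↦ (g x)^p` is smooth where the real function `g` is smooth and positive. -/
private theorem contDiffOn_cpow_comp {g : ℝ → ℝ} {U : Set ℝ}
    (hg : ContDiffOn ℝ ((⊤ : ℕ∞) : WithTop ℕ∞) g U) (hpos : ∀ x ∈ U, 0 < g x) (p : ℂ) :
    ContDiffOn ℝ ((⊤ : ℕ∞) : WithTop ℕ∞) (fun x => ((g x : ℝ) : ℂ) ^ p) U :=
  (contDiffOn_ofReal_cpow p).comp hg fun x hx => hpos x hx

/-- Product of principal powers of the same positive real: `t^p · t^q = t^{p+q}`. -/
private theorem cpow_mul_cpow_ofReal {t : ℝ} (ht : 0 < t) (p q : ℂ) :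
    ((t : ℝ) : ℂ) ^ p * ((t : ℝ) : ℂ) ^ q = ((t : ℝ) : ℂ) ^ (p + q) := by
  rw [Complex.cpow_add _ _ (by exact_mod_cast ht.ne')]

end SpinFlipTS


namespace RouteW

open Literature.Analysis.ODE Literature.Analysis.ODE.GeneralHeun
open Literature.Geometry.Lorentzian Literature.Geometry.Lorentzian.KerrDeSitter
open SpinFlipTS

/-! ### Clause (c): the polynomial kernel on the lattice -/

/-- **The spin-flip chain with clause (c).** For a generic-boundary spin-`s` radial solution `R`
(`2s = N ≥ 1`) the Teukolsky–Starobinsky image `R'` (spin `−s`, `λ' = lamFlip`) is a generic-boundary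
radial solution (as in `spinFlip_core`); and IF `R' ≡ 0` then at every lattice point
`s + 2B(r_c) = j`, `j ∈ ℕ`, `j + 1 ≤ N`, the Hatsuda-gauge function of `R` is
`x^{1−γ}(z_r−x)^{1−ε}·r(x)` on `(0,1)` for a polynomial `r` with `deg r + j + 1 ≤ N`. PROVED,
0 cited facts. -/
theorem spinFlip_polynomial (M a Λ s : ℝ) (ω : ℂ) (m : ℝ) (lam : ℂ) (R : ℝ → ℂ) (N : ℕ)
    (hsub : IsSubextremal M a Λ) (hN1 : 1 ≤ N) (hsN : 2 * s = N)
    (hR : IsRadialTeukolskySolution M a Λ s ω m lam R) (hin : IsIngoingAtEventHorizon M a Λ s ω m R)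
    (hout : IsOutgoingAtCosmoHorizon M a Λ ω m R) :
    ∃ R' : ℝ → ℂ, IsRadialTeukolskySolution M a Λ (-s) ω m (lamFlip a Λ s lam) R' ∧
      IsIngoingAtEventHorizon M a Λ (-s) ω m R' ∧ IsOutgoingAtCosmoHorizon M a Λ ω m R' ∧
      ((∀ r ∈ Ioo (rPlus M a Λ) (rCosmo M a Λ), R' r = 0) →
        ∀ j : ℕ, j + 1 ≤ N → (s : ℂ) + 2 * horizonB M a Λ ω m (rCosmo M a Λ) = (j : ℂ) →
          ∃ r : Polynomial ℂ, r.natDegree + j + 1 ≤ N ∧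
            ∀ x ∈ Ioo (0 : ℝ) 1,
              R (mobiusInv M a Λ x) / heunWeight M a Λ s ω m (mobiusInv M a Λ x) =
                (x : ℂ) ^ (1 - heunGamma M a Λ s ω m) *
                  ((mobiusZr M a Λ - x : ℝ) : ℂ) ^ (1 - heunEps M a Λ s ω m) * r.eval (x : ℂ)) := by
  -- Hatsuda data of spin `s` and `−s`
  set zr := mobiusZr M a Λ with hzrdef
  have hzr : 1 < zr := one_lt_mobiusZr hsub
  set γ := heunGamma M a Λ s ω m with hγ
  set δ := heunDelta M a Λ s ω m with hδ
  set ε := heunEps M a Λ s ω m with hε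
  set σp := heunSigmaPlus s with hσp
  set σm := heunSigmaMinus M a Λ s ω m with hσm
  set q := heunV M a Λ s ω m lam with hq
  set γ' := heunGamma M a Λ (-s) ω m with hγ'
  set δ' := heunDelta M a Λ (-s) ω m with hδ'
  set ε' := heunEps M a Λ (-s) ω m with hε'
  set σp' := heunSigmaPlus (-s) with hσp'
  set σm' := heunSigmaMinus M a Λ (-s) ω m with hσm'
  set q' := heunV M a Λ (-s) ω m (lamFlip a Λ s lam) with hq'
  set ρ := mobiusInv M a Λ with hρ
  set w := heunWeight M a Λ s ω m with hw
  -- the Hatsuda-gauge function of `R` and its flip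
  set y : ℝ → ℂ := fun x => R (ρ x) / w (ρ x) with hy
  set ytil : ℝ → ℂ := fun x => flipWeight zr γ δ ε x * y x with hytil
  set u : ℝ → ℂ := deriv^[N] ytil with hu
  set ym : ℝ → ℂ := fun x => flipWeight zr (2 - γ') (2 - δ') (2 - ε') x * u x with hym
  set R' : ℝ → ℂ := fun r => heunWeight M a Λ (-s) ω m r * ym (mobiusZ M a Λ r) with hR'
  -- (1) equations
  have hysol : IsSolutionOn (zr : ℂ) σp σm γ δ ε q (Ioo 0 1) y :=
    heunSolution_of_isRadialTeukolskySolution hsub hR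
  have hF : γ + δ + ε = σp + σm + 1 := heun_fuchs hsub s ω m
  have hytilsol : IsSolutionOn (zr : ℂ) (2 - σp) (2 - σm) (2 - γ) (2 - δ) (2 - ε)
      (flipQ zr γ δ ε q) (Ioo 0 1) ytil :=
    isSolutionOn_flip hzr hF Subset.rfl hysol
  have hlead : ∀ x ∈ Ioo (0 : ℝ) 1, lead (zr : ℂ) x ≠ 0 := by
    intro x hx
    unfold lead
    have h0 : (x : ℂ) ≠ 0 := by exact_mod_cast hx.1.ne'
    have h1 : (x : ℂ) - 1 ≠ 0 := by
      have : ((x - 1 : ℝ) : ℂ) ≠ 0 := by exact_mod_cast (show x - 1 ≠ 0 by linarith [hx.2])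
      simpa using this
    have ha : (x : ℂ) - zr ≠ 0 := by
      have : ((x - zr : ℝ) : ℂ) ≠ 0 := by exact_mod_cast (show x - zr ≠ 0 by linarith [hx.2])
      simpa using this
    exact mul_ne_zero (mul_ne_zero h0 h1) ha
  have hytil_smooth : ContDiffOn ℝ ((⊤ : ℕ∞) : WithTop ℕ∞) ytil (Ioo 0 1) :=
    contDiffOn_of_isSolutionOn isOpen_Ioo hlead hytilsol
  have hα : 2 - σp = 1 - (N : ℂ) := two_sub_sigmaPlus s hsN
  have hF' : (2 - γ) + (2 - δ) + (2 - ε) = (2 - σp) + (2 - σm) + 1 := fuchs_flip hF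
  have husol₀ := isSolutionOn_iterate_deriv hF' hN1 hα isOpen_Ioo hytil_smooth hytilsol
  have husol : IsSolutionOn (zr : ℂ) (2 - σp') (2 - σm') (2 - γ') (2 - δ') (2 - ε')
      (flipQ zr γ' δ' ε' q') (Ioo 0 1) u := by
    have e1 : (N : ℂ) + 1 = 2 - σp' := image_sigmaPlus s hsN
    have e2 : 2 - σm + N = 2 - σm' := image_sigmaMinus M a Λ s ω m hsN
    have e3 : 2 - γ + N = 2 - γ' := image_gamma M a Λ s ω m hsN
    have e4 : 2 - δ + N = 2 - δ' := image_delta M a Λ s ω m hsN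
    have e5 : 2 - ε + N = 2 - ε' := image_eps M a Λ s ω m hsN
    have e6 := accessory_identity hsub s ω m lam hsN
    rw [e1, e2, e3, e4, e5, e6] at husol₀
    exact husol₀
  have hF'' : (2 - γ') + (2 - δ') + (2 - ε') = (2 - σp') + (2 - σm') + 1 :=
    fuchs_flip (heun_fuchs hsub (-s) ω m)
  have hymsol : IsSolutionOn (zr : ℂ) σp' σm' γ' δ' ε' q' (Ioo 0 1) ym := by
    have h := isSolutionOn_flip hzr hF'' Subset.rfl husol
    simp only [sub_sub_cancel, flipQ_flipQ] at h
    exact h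
  have hR'sol : IsRadialTeukolskySolution M a Λ (-s) ω m (lamFlip a Λ s lam) R' :=
    isRadialTeukolskySolution_of_heunSolution hsub hymsol
  -- (2) boundary shape at `x = 0` (event horizon): `ytil` is smooth across `0`
  obtain ⟨e₀, he₀, G, hG, hyG⟩ := heunSolution_branch_at_zero hsub hin
  set e := min e₀ 1 with hedef
  have he : 0 < e := lt_min he₀ one_pos
  have he1 : e ≤ 1 := min_le_right _ _
  have hee₀ : e ≤ e₀ := min_le_left _ _
  set F : ℝ → ℂ := fun x => ((1 - x : ℝ) : ℂ) ^ (δ - 1) * ((zr - x : ℝ) : ℂ) ^ (ε - 1) * G x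
    with hFdef
  have hFs : ContDiffOn ℝ ((⊤ : ℕ∞) : WithTop ℕ∞) F (Ioo (-e) e) := by
    have hG' : ContDiffOn ℝ ((⊤ : ℕ∞) : WithTop ℕ∞) G (Ioo (-e) e) :=
      hG.mono (Ioo_subset_Ioo (by linarith) hee₀)
    refine (ContDiffOn.mul ?_ ?_).mul hG'
    · exact contDiffOn_cpow_comp ((contDiff_const.sub contDiff_id).contDiffOn)
        (fun x hx => by have := hx.1; have := hx.2; (try simp only [id]); linarith) _
    · exact contDiffOn_cpow_comp ((contDiff_const.sub contDiff_id).contDiffOn)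
        (fun x hx => by have := hx.1; have := hx.2; (try simp only [id]); linarith) _
  have hagree0 : ∀ x ∈ Ioo 0 e, ytil x = F x := by
    intro x hx
    have hx0 : (0 : ℝ) < x := hx.1
    have hxG := hyG x ⟨hx0, lt_of_lt_of_le hx.2 hee₀⟩
    simp only [hytil, hFdef, flipWeight]
    rw [show y x = (x : ℂ) ^ (1 - γ) * G x from hxG]
    have hc : (x : ℂ) ^ (γ - 1) * (x : ℂ) ^ (1 - γ) = 1 := by
      rw [cpow_mul_cpow_ofReal hx0, show γ - 1 + (1 - γ) = 0 by ring, Complex.cpow_zero]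
    linear_combination ((1 - x : ℝ) : ℂ) ^ (δ - 1) * ((zr - x : ℝ) : ℂ) ^ (ε - 1) * G x * hc
  obtain ⟨hDF, huF⟩ := iterate_deriv_of_agree hFs hagree0 N
  have h0m : IsHeunBranchAtZero M a Λ (-s) ω m ym := by
    refine ⟨e, he, fun x => ((1 - x : ℝ) : ℂ) ^ (1 - δ') * ((zr - x : ℝ) : ℂ) ^ (1 - ε') *
      (deriv^[N] F) x, ?_, fun x hx => ?_⟩
    · refine (ContDiffOn.mul ?_ ?_).mul hDF
      · exact contDiffOn_cpow_comp ((contDiff_const.sub contDiff_id).contDiffOn)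
          (fun x hx => by have := hx.1; have := hx.2; (try simp only [id]); linarith) _
      · exact contDiffOn_cpow_comp ((contDiff_const.sub contDiff_id).contDiffOn)
          (fun x hx => by have := hx.1; have := hx.2; (try simp only [id]); linarith) _
    · simp only [hym, flipWeight]
      rw [show u x = (deriv^[N] F) x from huF x hx]
      rw [show (2 : ℂ) - γ' - 1 = 1 - heunGamma M a Λ (-s) ω m by rw [hγ']; ring,
        show (2 : ℂ) - δ' - 1 = 1 - δ' by ring, show (2 : ℂ) - ε' - 1 = 1 - ε' by ring]
      ring
  -- (3) boundary shape at `x = 1` (cosmological horizon): `ytil = (1−x)^{δ−1}·G₁`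
  obtain ⟨e₁, he₁, Fs, hFs1, hyF⟩ := heunSolution_smooth_at_one hsub s hout
  set d := min e₁ (min 1 (zr - 1)) with hddef
  have hd : 0 < d := lt_min he₁ (lt_min one_pos (by linarith))
  have hd1 : d ≤ 1 := (min_le_right _ _).trans (min_le_left _ _)
  have hdz : d ≤ zr - 1 := (min_le_right _ _).trans (min_le_right _ _)
  have hde₁ : d ≤ e₁ := min_le_left _ _
  set G₁ : ℝ → ℂ := fun x => (x : ℂ) ^ (γ - 1) * ((zr - x : ℝ) : ℂ) ^ (ε - 1) * Fs x with hG₁def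
  have hG₁ : ContDiffOn ℝ ((⊤ : ℕ∞) : WithTop ℕ∞) G₁ (Ioo (1 - d) (1 + d)) := by
    have hFs' : ContDiffOn ℝ ((⊤ : ℕ∞) : WithTop ℕ∞) Fs (Ioo (1 - d) (1 + d)) :=
      hFs1.mono (Ioo_subset_Ioo (by linarith) (by linarith))
    refine (ContDiffOn.mul ?_ ?_).mul hFs'
    · have := contDiffOn_cpow_comp (g := fun x : ℝ => x) (U := Ioo (1 - d) (1 + d))
        contDiff_id.contDiffOn (fun x hx => by have := hx.1; have := hx.2; linarith) (γ - 1)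
      simpa using this
    · exact contDiffOn_cpow_comp ((contDiff_const.sub contDiff_id).contDiffOn)
        (fun x hx => by have := hx.1; have := hx.2; (try simp only [id]); linarith) _
  have hbranch1 : ∀ x ∈ Ioo (1 - d) 1, ytil x = ((1 - x : ℝ) : ℂ) ^ (δ - 1) * G₁ x := by
    intro x hx
    have hxF := hyF x ⟨by linarith [hx.1], hx.2⟩
    simp only [hytil, hG₁def, flipWeight]
    rw [show y x = Fs x from hxF]
    ring
  have hH := iterate_deriv_of_branch hG₁ hbranch1 N
  have hHs : ContDiffOn ℝ ((⊤ : ℕ∞) : WithTop ℕ∞) (branchCoeff (δ - 1) G₁ N) (Ioo (1 - d) (1 + d)) :=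
    branchCoeff_smooth (δ - 1) isOpen_Ioo hG₁ N
  have h1m : IsHeunRegularAtOne ym := by
    refine ⟨d, hd, fun x => (x : ℂ) ^ (1 - γ') * ((zr - x : ℝ) : ℂ) ^ (1 - ε') *
      branchCoeff (δ - 1) G₁ N x, ?_, fun x hx => ?_⟩
    · refine (ContDiffOn.mul ?_ ?_).mul hHs
      · have := contDiffOn_cpow_comp (g := fun x : ℝ => x) (U := Ioo (1 - d) (1 + d))
          contDiff_id.contDiffOn (fun x hx => by have := hx.1; have := hx.2; linarith) (1 - γ')
        simpa using this
      · exact contDiffOn_cpow_comp ((contDiff_const.sub contDiff_id).contDiffOn)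
          (fun x hx => by have := hx.1; have := hx.2; (try simp only [id]); linarith) _
    · have hx1 : (0 : ℝ) < 1 - x := by linarith [hx.2]
      simp only [hym, flipWeight]
      rw [show u x = (deriv^[N] ytil) x from rfl, hH x hx]
      have hexp : ((1 - x : ℝ) : ℂ) ^ ((2 : ℂ) - δ' - 1) * ((1 - x : ℝ) : ℂ) ^ (δ - 1 - (N : ℕ)) = 1 := by
        rw [cpow_mul_cpow_ofReal hx1]
        have : (2 : ℂ) - δ' - 1 + (δ - 1 - (N : ℕ)) = 0 := by
          have := delta_sub_delta M a Λ s ω m hsN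
          rw [← hδ, ← hδ'] at this
          linear_combination this
        rw [this, Complex.cpow_zero]
      rw [show (2 : ℂ) - γ' - 1 = 1 - γ' by ring, show (2 : ℂ) - ε' - 1 = 1 - ε' by ring]
      linear_combination (x : ℂ) ^ (1 - γ') * ((zr - x : ℝ) : ℂ) ^ (1 - ε') *
        branchCoeff (δ - 1) G₁ N x * hexp
  have hin' : IsIngoingAtEventHorizon M a Λ (-s) ω m R' :=
    isIngoingAtEventHorizon_of_heun_branch_at_zero hsub (-s) ω m h0m
  have hout' : IsOutgoingAtCosmoHorizon M a Λ ω m R' :=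
    isOutgoingAtCosmoHorizon_of_heun_smooth_at_one hsub (-s) ω m h1m
  refine ⟨R', hR'sol, hin', hout', fun hR'0 => ?_⟩
  -- (4) consequences of `R' ≡ 0`
  have hz1 := one_lt_mobiusZinf hsub
  have hym0 : ∀ x ∈ Ioo (0 : ℝ) 1, ym x = 0 := by
    intro x hx
    have hxinf : x ≠ mobiusZinf M a Λ := ne_of_lt (hx.2.trans hz1)
    have hρx : ρ x ∈ Ioo (rPlus M a Λ) (rCosmo M a Λ) := mobiusInv_mem_Ioo hsub hx
    have h := hR'0 (ρ x) hρx
    simp only [hR'] at h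
    rw [hρ, mobiusZ_mobiusInv hsub hxinf] at h
    exact (mul_eq_zero.mp h).resolve_left (heunWeight_ne_zero hsub (-s) ω m hρx)
  have hu0 : ∀ x ∈ Ioo (0 : ℝ) 1, u x = 0 := fun x hx =>
    (flip_eq_zero_iff hzr (2 - γ') (2 - δ') (2 - ε') hx).mp (hym0 x hx)
  -- `ytil ≡ 0 ⇒ R ≡ 0`
  have hR_of_ytil : (∀ x ∈ Ioo (0 : ℝ) 1, ytil x = 0) →
      ∀ r ∈ Ioo (rPlus M a Λ) (rCosmo M a Λ), R r = 0 := by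
    intro hytil0 r hr
    have hx : mobiusZ M a Λ r ∈ Ioo (0 : ℝ) 1 := mobiusZ_mem_Ioo hsub hr
    have hy0 : y (mobiusZ M a Λ r) = 0 := (flip_eq_zero_iff hzr γ δ ε hx).mp (hytil0 _ hx)
    have hrm : r ≠ rMinus M a Λ := by
      obtain ⟨-, -, h01, -⟩ := hsub
      intro h; rw [h] at hr; exact absurd hr.1 (not_lt.mpr h01.le)
    simp only [hy, hρ, mobiusInv_mobiusZ hsub hrm] at hy0
    exact (div_eq_zero_iff.mp hy0).resolve_right (heunWeight_ne_zero hsub s ω m hr)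

  -- (4c) the polynomial kernel at the lattice point `δ − 1 = j`
  intro j hjN hlat
  have hμ : δ - 1 = (j : ℂ) := by rw [hδ, delta_sub_one]; exact hlat
  obtain ⟨P, hPdeg, hP⟩ := exists_polynomial_of_iterate_deriv_eq_zero zero_lt_one N hytil_smooth hu0
  -- recovering `y` from `ytil = (1−x)^j · r(x)`
  have hy_of : ∀ rr : Polynomial ℂ,
      (∀ x ∈ Ioo (0 : ℝ) 1, ytil x = ((1 - x : ℝ) : ℂ) ^ j * rr.eval (x : ℂ)) →
      ∀ x ∈ Ioo (0 : ℝ) 1,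
        y x = (x : ℂ) ^ (1 - γ) * ((zr - x : ℝ) : ℂ) ^ (1 - ε) * rr.eval (x : ℂ) := by
    intro rr hrr x hx
    have hx0 : (0 : ℝ) < x := hx.1
    have hx1 : (0 : ℝ) < 1 - x := by linarith [hx.2]
    have hxz : (0 : ℝ) < zr - x := by linarith [hx.2]
    have h := hrr x hx
    simp only [hytil, flipWeight] at h
    rw [hμ, Complex.cpow_natCast] at h
    have hne1 : ((1 - x : ℝ) : ℂ) ^ j ≠ 0 := pow_ne_zero _ (by exact_mod_cast hx1.ne')
    have hc0 : (x : ℂ) ^ (1 - γ) * (x : ℂ) ^ (γ - 1) = 1 := by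
      rw [cpow_mul_cpow_ofReal hx0, show (1 - γ) + (γ - 1) = 0 by ring, Complex.cpow_zero]
    have hcz : ((zr - x : ℝ) : ℂ) ^ (1 - ε) * ((zr - x : ℝ) : ℂ) ^ (ε - 1) = 1 := by
      rw [cpow_mul_cpow_ofReal hxz, show (1 - ε) + (ε - 1) = 0 by ring, Complex.cpow_zero]
    have h2 : ((1 - x : ℝ) : ℂ) ^ j *
        (y x - (x : ℂ) ^ (1 - γ) * ((zr - x : ℝ) : ℂ) ^ (1 - ε) * rr.eval (x : ℂ)) = 0 := by
      linear_combination ((x : ℂ) ^ (1 - γ) * ((zr - x : ℝ) : ℂ) ^ (1 - ε)) * h -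
        ((1 - x : ℝ) : ℂ) ^ j * y x * (((zr - x : ℝ) : ℂ) ^ (1 - ε) * ((zr - x : ℝ) : ℂ) ^ (ε - 1)) * hc0 -
        ((1 - x : ℝ) : ℂ) ^ j * y x * hcz
    exact sub_eq_zero.mp ((mul_eq_zero.mp h2).resolve_left hne1)
  by_cases hP0 : P = 0
  · refine ⟨0, by simp only [natDegree_zero]; omega, hy_of 0 fun x hx => ?_⟩
    rw [hP x hx, hP0]
    simp
  obtain ⟨qq, hPq, hqdvd⟩ := exists_eq_pow_rootMultiplicity_mul_and_not_dvd P hP0 1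
  set n := P.rootMultiplicity 1 with hn
  have hqq1 : qq.eval 1 ≠ 0 := fun h0 => hqdvd (dvd_iff_isRoot.mpr h0)
  have hqq0 : qq ≠ 0 := by rintro rfl; simp at hqq1
  have hPnat : P.natDegree < N := (natDegree_lt_iff_degree_lt hP0).mpr hPdeg
  have hdeg : P.natDegree = n + qq.natDegree := by
    have h := congrArg natDegree hPq
    rwa [natDegree_mul (pow_ne_zero _ (X_sub_C_ne_zero 1)) hqq0, natDegree_pow, natDegree_X_sub_C,
      mul_one] at h
  -- the outgoing branch forces `n − j ∈ ℕ`
  set Q : ℝ → ℂ := fun x => (-1) ^ n * qq.eval (x : ℂ) with hQdef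
  have hQs : ContDiffOn ℝ ((⊤ : ℕ∞) : WithTop ℕ∞) Q (Ioo (1 - d) (1 + d)) := by
    have h1 : ContDiff ℝ ((⊤ : ℕ∞) : WithTop ℕ∞) (fun x : ℝ => qq.eval (x : ℂ)) := by
      have hq0' : ContDiff ℂ ((⊤ : ℕ∞) : WithTop ℕ∞) (fun x : ℂ => aeval x qq) :=
        Polynomial.contDiff_aeval qq _
      have hq' := hq0'.restrict_scalars ℝ
      have e1 : (fun x : ℂ => aeval x qq) = fun x : ℂ => qq.eval x := by
        funext x; simp [coe_aeval_eq_eval]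
      rw [e1] at hq'
      exact hq'.comp Complex.ofRealCLM.contDiff
    exact (contDiff_const.mul h1).contDiffOn
  have hQ1 : Q 1 ≠ 0 := by
    simp only [hQdef, Complex.ofReal_one]
    exact mul_ne_zero (pow_ne_zero _ (by norm_num)) hqq1
  have hagree : ∀ x ∈ Ioo (1 - d) 1, ((1 - x : ℝ) : ℂ) ^ ((n : ℂ) - (j : ℂ)) * Q x = G₁ x := by
    intro x hx
    have hx01 : x ∈ Ioo (0 : ℝ) 1 := ⟨by linarith [hx.1], hx.2⟩
    have hpos : (0 : ℝ) < 1 - x := by linarith [hx.2]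
    have hne : ((1 - x : ℝ) : ℂ) ≠ 0 := by exact_mod_cast hpos.ne'
    have h1 := hbranch1 x hx
    rw [hP x hx01, hPq, eval_mul, eval_pow, eval_sub, eval_X, eval_C, hμ] at h1
    have hG' : G₁ x = ((1 - x : ℝ) : ℂ) ^ (-(j : ℂ)) * (((x : ℂ) - 1) ^ n * qq.eval (x : ℂ)) := by
      rw [h1, ← mul_assoc, ← Complex.cpow_add _ _ hne, neg_add_cancel, Complex.cpow_zero, one_mul]
    rw [hG', hQdef, Complex.cpow_sub _ _ hne, Complex.cpow_natCast, Complex.cpow_neg,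
      Complex.cpow_natCast]
    have e2 : ((x : ℂ) - 1) = -((1 - x : ℝ) : ℂ) := by push_cast; ring
    rw [e2, neg_pow]
    field_simp
    ring
  obtain ⟨n', hn'⟩ := natural_of_smooth_branch hd hQs hQ1 hG₁ hagree
  have hnj : n = j + n' := by
    have e : ((n : ℂ) - (j : ℂ)) = (((n : ℤ) - (j : ℤ) : ℤ) : ℂ) := by push_cast; ring
    rw [e] at hn'
    have h' : (n : ℤ) - j = n' := by exact_mod_cast hn'
    omega
  refine ⟨Polynomial.C ((-1 : ℂ) ^ j) * (X - Polynomial.C 1) ^ n' * qq, ?_, hy_of _ fun x hx => ?_⟩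
  · have h1 : (Polynomial.C ((-1 : ℂ) ^ j) * (X - Polynomial.C 1) ^ n' * qq).natDegree ≤
        n' + qq.natDegree := by
      calc _ ≤ (Polynomial.C ((-1 : ℂ) ^ j) * (X - Polynomial.C 1) ^ n').natDegree + qq.natDegree :=
            natDegree_mul_le
        _ ≤ ((X - Polynomial.C (1 : ℂ)) ^ n').natDegree + qq.natDegree := by
            gcongr; exact natDegree_C_mul_le _ _
        _ ≤ n' * (X - Polynomial.C (1 : ℂ)).natDegree + qq.natDegree := by
            gcongr; exact natDegree_pow_le
        _ = n' + qq.natDegree := by rw [natDegree_X_sub_C, mul_one]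
    omega
  · rw [hP x hx, hPq, hnj]
    simp only [eval_mul, eval_pow, eval_sub, eval_X, eval_C]
    have e2 : ((x : ℂ) - 1) = -((1 - x : ℝ) : ℂ) := by push_cast; ring
    rw [e2, pow_add, neg_pow, neg_pow]
    ring

end RouteW

end Summit.Ventures.KdS
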